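import Literature.IUT.HodgeTheaters.TemperedCoveringsCor23viSurfaceTypeBranchGluing
import Literature.IUT.HodgeTheaters.TemperedCoveringsCor23viHatIncidenceOfSeparatingQuotient
import Literature.AnabelianGeometry.SemiGraphs.TemperedSeparatingQuotientOfCovering
import Mathlib.GroupTheory.SemidirectProduct
import HarnessLib

/-!
# [IUTchI] Cor. 2.3 (vi): the pro-`Σ̂` incidence `hF` at a cusp of a vertex of POSITIVE GENUS of a semi-graph of
# anabelioids of SURFACE TYPE — a THEOREM by the one-level criterion (a HEISENBERG translation covering)

S. Mochizuki, *Inter-universal Teichmüller theory I*, kurims manuscript (May 2020), §2, Cor. 2.3 (vi) p. 48 l. 6–16, proof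
p. 49 l. 62–64 [cite: Mochizuki2012, Cor 2.3(vi) pp.48-49] (D-0012 claim key; series DISPUTED; nothing of it is asserted
here); S. Mochizuki, *Semi-graphs of anabelioids*, Publ. RIMS **42** (2006), Example 2.10 p. 31, §3 Def. 3.5 (i)/(ii) p. 37,
Prop. 3.6 (iii) p. 38, Thm. 3.7 (i)/(iii) pp. 40–41 [cite: MochizukiSemiAnbd2006, Ex. 2.10 p.31].

PROOF-ONLY file (abc-iut cell, seat abc-iut-L5-d5 gen 10, self-named count-neutral in-lineage row
«COR23VI-HF-TWO-LEVEL@CAVEAT», complement to `…HatCuspIncidenceDoublyBound.lean` / `…HatCuspIncidenceTwoCusps.lean`;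
cone row `IUTchI:Cor2.3(vi)`, GAP-LEDGER G-w4d059-g8-1; no definition, no instance, no notation, no `Prop` fact; the
shear action `σ` is a `let` inside a proof, as in abc-iut-L3-t4's `exists_hom_heisenberg_surjective`).  Consumed BY NAME:
`TranslationCover.exists_cover`, `SurfaceTypeCharacters.exists_dense_zpowers_edgeGroup` / `continuous_of_isOpen_ker`,
abc-iut-L3's `IsProSigmaCompletion.exists_hom_extension`, abc-iut-L3-t11's
`exists_openNormal_separating_decomp_singleVertex_of_covering` (p502554), abc-iut-w4-d070's
`not_map_le_conj_closure_of_openNormal` (p498282), abc-iut-L3-t2's `FiniteIsTempered_holds`.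

* `exists_hom_heisenberg_single_cusp` — for `g ≥ 1` and a cusp `j₀`: `f : Γ_{g,r} → (ℤ/ℓ)² ⋊ ℤ/ℓ` (Heisenberg mod `ℓ`,
  order `ℓ³`) with `a₁ ↦ x`, `b₁ ↦ y`, `c_{j₀} ↦ [x,y]⁻¹ ≠ 1`, every other generator `↦ 1`;
* **`PositiveGenus.not_map_le_conj_closure_of_pos_genus`** — for `𝒢 : ProfiniteSemiGraph` with the hypotheses of
  [SemiAnbd] Prop. 3.6, a vertex `u` carrying the surface-type datum of Example 2.10 with `g ≥ 1` (no datum needed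
  elsewhere), a prime `ℓ ∈ Σ`, a vertex `w ≠ u` and a cusp `e` at `u`: for every chart, completion, `Π^tp_ℍ := TpH ∈
  decompSubgroups c ⟨{w}, ∅⟩`, edge-like `L` at `e` and `g`:  `ι(L) ⊄ g · closure ι(TpH) · g⁻¹`.  The Heisenberg
  translation covering (`Π_u → (ℤ/ℓ)² ⋊ ℤ/ℓ` extending `f`; trivial at every other vertex; identity gluings, since every
  other branch group at `u` is mapped into a conjugate of `f(⟨c_j⟩) = 1`) is split over `w`, while the conjugated cusp
  generator of `Π_e` acts by `Λx · [x,y]⁻¹ · (Λx)⁻¹ ≠ 1` — p498282's one-level criterion.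

COVERAGE (with the two companions): `hF`'s premise fails at every cusp of a vertex `u ∉ ℍ = {w}` that has genus `≥ 1`, OR
a second cusp, OR two edges to `w`; what remains at a single-vertex `ℍ` is the genus-`0`, single-cusp, `≤ 1`-edge-to-`w`
configuration (compensation away from `u`, GAP-LEDGER D-G-w4d059-g8-1 route (C3)).  BINDER CENSUS: LAW 0 · FACT 0 ·
ORIGIN 1 (the surface-type datum at `u`, ORIGIN only at the genuine `S.Gc`).  HONEST LIMITS as in the companions.
Nothing here bears on [IUTchIII] Cor. 3.12; typed ≠ inhabited ≠ discharged; nothing asserts that abc is proved or refuted.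
-/

noncomputable section

namespace Literature.IUT.HodgeTheaters

open _root_.Topology CategoryTheory
open scoped Pointwise
open Literature.AnabelianGeometry.SemiGraphs
open Literature.AnabelianGeometry.SemiGraphs.ProfiniteSemiGraph
open Literature.AnabelianGeometry.SemiGraphs.SemiGraphOfAnabelioids (IsProSigmaCompletion)
open Literature.AnabelianGeometry.Anabelioids (IsSigmaInteger)
open Literature.GroupTheory.CombinatorialGroupTheory
open Literature.GroupTheory.CombinatorialGroupTheory.PuncturedSurfaceGroup
open Multiplicative SurfaceTypeCharacters TranslationCover DoublyBoundCusp

namespace PositiveGenus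

variable {𝒢 : ProfiniteSemiGraph.{0}} {ℓ : ℕ} [hℓ : Fact ℓ.Prime]

/-- In a list without duplicates, the product of a function equal to `1` off one entry `a` is its value at `a` (any
monoid). [cite: MochizukiSemiAnbd2006, Ex. 2.10 p.31] -/
theorem prod_map_eq_of_eq_one_off {α M : Type*} [DecidableEq α] [Monoid M] (l : List α) (hl : l.Nodup) (a : α)
    (ha : a ∈ l) (f : α → M) (hf : ∀ b ∈ l, b ≠ a → f b = 1) : (l.map f).prod = f a := by
  induction l with
  | nil => exact absurd ha List.not_mem_nil
  | cons hd tl ih =>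
    rw [List.map_cons, List.prod_cons]
    rcases List.mem_cons.mp ha with rfl | hmem
    · have htl : (tl.map f).prod = 1 := List.prod_eq_one fun m hm => by
        obtain ⟨b, hb, rfl⟩ := List.mem_map.mp hm
        exact hf b (List.mem_cons_of_mem _ hb) fun h => (List.nodup_cons.mp hl).1 (h ▸ hb)
      rw [htl, mul_one]
    · have hhd : f hd = 1 := hf hd List.mem_cons_self fun h => (List.nodup_cons.mp hl).1 (h ▸ hmem)
      rw [hhd, one_mul]
      exact ih (List.nodup_cons.mp hl).2 hmem fun b hb hba => hf b (List.mem_cons_of_mem _ hb) hba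

/-- A homomorphism with OPEN kernel maps the closure of a subgroup into the image of the subgroup (any target group).
[cite: MochizukiSemiAnbd2006, Ex. 2.10 p.31] -/
theorem apply_mem_map_of_mem_closure {P : Type*} [Group P] [TopologicalSpace P] [IsTopologicalGroup P]
    {M : Type*} [Group M] (χ : P →* M) (hχ : IsOpen (χ.ker : Set P)) (S : Subgroup P) {y : P}
    (hy : y ∈ S.topologicalClosure) : χ y ∈ S.map χ := by
  have hopen : IsOpen ((fun z => y⁻¹ * z) ⁻¹' (χ.ker : Set P)) := hχ.preimage (continuous_const.mul continuous_id)
  have hmem : y ∈ (fun z => y⁻¹ * z) ⁻¹' (χ.ker : Set P) := by simp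
  obtain ⟨s, hs, hsS⟩ := mem_closure_iff.mp hy _ hopen hmem
  have hs' : χ (y⁻¹ * s) = 1 := hs
  rw [map_mul, map_inv, inv_mul_eq_one] at hs'
  exact ⟨s, hsS, hs'.symm⟩

/-- **A Heisenberg quotient of `Γ_{g,r}` (`g ≥ 1`) killing all cusps but one.**  For `0 < g`, a cusp `j₀` and `ℓ`, there are
an action `σ` of `ℤ/ℓ` on `(ℤ/ℓ)²` by shears and `f : Γ_{g,r} → (ℤ/ℓ)² ⋊ ℤ/ℓ` (the Heisenberg group mod `ℓ`, of order `ℓ³`)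
with `f(c_j) = 1` for `j ≠ j₀` and `f(c_{j₀}) = z⁻¹ ≠ 1`, `z = [x, y]` the central commutator (`a₁ ↦ x`, `b₁ ↦ y`,
the other genus generators `↦ 1`; the relator `[a₁,b₁]⋯c₁⋯c_r ↦ z · z⁻¹ = 1`). [cite: MochizukiSemiAnbd2006, Ex. 2.10 p.31] -/
theorem exists_hom_heisenberg_single_cusp {g r : ℕ} (hg : 0 < g) (j₀ : Fin r) (ℓ : ℕ) [NeZero ℓ] :
    ∃ (σ : Multiplicative (ZMod ℓ) →* MulAut (Multiplicative (ZMod ℓ × ZMod ℓ)))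
      (f : PuncturedSurfaceGroup g r →* (Multiplicative (ZMod ℓ × ZMod ℓ) ⋊[σ] Multiplicative (ZMod ℓ))),
      (∀ j, j ≠ j₀ → f (c j) = 1) ∧ f (c j₀) = (SemidirectProduct.inl (ofAdd (0, 1)))⁻¹ := by
  obtain ⟨g', rfl⟩ : ∃ g', g = g' + 1 := ⟨g - 1, by omega⟩
  let σ : Multiplicative (ZMod ℓ) →* MulAut (Multiplicative (ZMod ℓ × ZMod ℓ)) :=
    { toFun := fun t =>
        { toFun := fun q => ofAdd (q.toAdd.1, q.toAdd.2 + t.toAdd * q.toAdd.1)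
          invFun := fun q => ofAdd (q.toAdd.1, q.toAdd.2 - t.toAdd * q.toAdd.1)
          left_inv := fun q => by simp
          right_inv := fun q => by simp
          map_mul' := fun q q' => by
            rw [← ofAdd_add, Prod.mk_add_mk, toAdd_mul, Prod.fst_add, Prod.snd_add]
            exact congrArg ofAdd (Prod.ext rfl (by dsimp only; ring)) }
      map_one' := by
        ext q
        · simp
        · simp
      map_mul' := fun t t' => by
        ext q
        · simp
        · simp only [toAdd_mul, MulAut.mul_apply, MulEquiv.coe_mk, Equiv.coe_fn_mk, toAdd_ofAdd]
          ring }
  have hσ : ∀ (t : Multiplicative (ZMod ℓ)) (p q : ZMod ℓ),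
      σ t (ofAdd (p, q)) = ofAdd (p, q + t.toAdd * p) := fun _ _ _ => rfl
  let x : Multiplicative (ZMod ℓ × ZMod ℓ) ⋊[σ] Multiplicative (ZMod ℓ) := SemidirectProduct.inr (ofAdd 1)
  let y : Multiplicative (ZMod ℓ × ZMod ℓ) ⋊[σ] Multiplicative (ZMod ℓ) := SemidirectProduct.inl (ofAdd (1, 0))
  let z : Multiplicative (ZMod ℓ × ZMod ℓ) ⋊[σ] Multiplicative (ZMod ℓ) := SemidirectProduct.inl (ofAdd (0, 1))
  have hxyx : x * y * x⁻¹ = SemidirectProduct.inl (ofAdd ((1 : ZMod ℓ), (1 : ZMod ℓ))) := by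
    rw [← map_inv, ← SemidirectProduct.inl_aut, hσ]
    simp
  have hz : x * y * x⁻¹ * y⁻¹ = z := by
    rw [hxyx, ← map_inv, ← map_mul, ← ofAdd_neg, ← ofAdd_add, Prod.neg_mk, Prod.mk_add_mk]
    simp [z]
  let F : puncturedSurfaceGen (g' + 1) r → Multiplicative (ZMod ℓ × ZMod ℓ) ⋊[σ] Multiplicative (ZMod ℓ) :=
    Sum.elim (fun ib => if ib.1 = 0 then (if ib.2 then y else x) else 1) fun j => if j = j₀ then z⁻¹ else 1
  have hx0 : F (Sum.inl (0, false)) = x := by simp [F]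
  have hy0 : F (Sum.inl (0, true)) = y := by simp [F]
  have hrel : ∀ w ∈ ({relator (g' + 1) r} : Set (FreeGroup (puncturedSurfaceGen (g' + 1) r))),
      FreeGroup.lift F w = 1 := by
    intro w hw
    rw [Set.mem_singleton_iff] at hw
    rw [hw, lift_relator]
    have h1 : ((List.finRange (g' + 1)).map fun i =>
        F (Sum.inl (i, false)) * F (Sum.inl (i, true)) * (F (Sum.inl (i, false)))⁻¹ *
          (F (Sum.inl (i, true)))⁻¹).prod = z := by
      rw [List.finRange_succ, List.map_cons, List.prod_cons, List.map_map]
      have htail : (List.map ((fun i : Fin (g' + 1) =>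
          F (Sum.inl (i, false)) * F (Sum.inl (i, true)) * (F (Sum.inl (i, false)))⁻¹ *
            (F (Sum.inl (i, true)))⁻¹) ∘ Fin.succ) (List.finRange g')).prod = 1 :=
        List.prod_eq_one fun t ht => by
          obtain ⟨i, -, rfl⟩ := List.mem_map.mp ht
          simp [F, Fin.succ_ne_zero i]
      rw [htail, mul_one, hx0, hy0]
      exact hz
    have h2 : ((List.finRange r).map fun j => F (Sum.inr j)).prod = z⁻¹ := by
      rw [prod_map_eq_of_eq_one_off (List.finRange r) (List.nodup_finRange r) j₀ (List.mem_finRange j₀)]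
      · simp [F]
      · intro b _ hb
        simp [F, hb]
    rw [h1, h2, mul_inv_cancel]
  refine ⟨σ, PresentedGroup.toGroup hrel, fun j hj => ?_, ?_⟩
  · rw [c, PresentedGroup.toGroup.of]
    simp [F, hj]
  · rw [c, PresentedGroup.toGroup.of]
    simp [F, z]

/-- **[IUTchI] Cor. 2.3 (vi): the premise of the pro-`Σ̂` incidence `hF` FAILS at every cusp of a vertex of POSITIVE GENUS**,
for every semi-graph of profinite groups with the hypotheses of [SemiAnbd] Prop. 3.6 whose vertex `u` carries the
surface-type datum of Example 2.10 with `g ≥ 1`.  For a prime `ℓ ∈ Σ`, a vertex `w ≠ u` and a cusp `e = edgeOf be` at `u`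
(its other branch abuts no vertex): for every chart, completion, `TpH ∈ decompSubgroups c ⟨{w}, ∅⟩`, edge-like `L` at `e`
and `g`, `ι(L) ⊄ g · closure ι(TpH) · g⁻¹`.  The HEISENBERG translation covering (`Π_u → (ℤ/ℓ)² ⋊ ℤ/ℓ`, `a₁ ↦ x`,
`b₁ ↦ y`, `c_{js e} ↦ [x,y]⁻¹`, every other generator and every other vertex trivial; identity gluings) is split over
`w` and moved by `Π_e` — p498282's one-level criterion. [cite: Mochizuki2012, Cor 2.3(vi) pp.48-49]
[cite: MochizukiSemiAnbd2006, Ex. 2.10 p.31] [claim: Mochizuki2012, status: disputed] -/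
theorem not_map_le_conj_closure_of_pos_genus (h36 : 𝒢.Prop36Hypotheses) {Sigma : Set ℕ} (hℓS : ℓ ∈ Sigma)
    {u w : 𝒢.graph.Vertex} (huw : u ≠ w)
    (hu : ∃ (g r : ℕ) (ι : PuncturedSurfaceGroup g r →* 𝒢.Gv u),
      0 < g ∧ IsProSigmaCompletion Sigma ι ∧
        ∃ js : 𝒢.graph.Star u → Fin r, Function.Injective js ∧
          ∀ b : 𝒢.graph.Star u, ∃ x : 𝒢.Gv u, 𝒢.branchSubgroup b.1 u b.2 =
            ConjAct.toConjAct x • ((cuspInertia (g := g) (js b)).map ι).topologicalClosure)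
    (be : 𝒢.graph.Star u)
    (hopen : ∀ b' : 𝒢.graph.Branch, 𝒢.graph.edgeOf b' = 𝒢.graph.edgeOf be.1 → b' ≠ be.1 → 𝒢.graph.abuts b' = none)
    (c : TemperedPiChart 𝒢) {Ghat : Type*} [Group Ghat] [TopologicalSpace Ghat] [IsTopologicalGroup Ghat]
    {ι : c.G →ₜ* Ghat} (hι : IsProfiniteCompletion ι) {TpH : Subgroup c.G}
    (hTpH : TpH ∈ c.decompSubgroups ⟨{w}, ∅⟩) {L : Subgroup c.G}
    (hL : L ∈ edgeLikeSubgroups c (𝒢.graph.edgeOf be.1)) (g : Ghat) :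
    ¬ L.map ι.toMonoidHom ≤ MulAut.conj g • (TpH.map ι.toMonoidHom).topologicalClosure := by
  classical
  haveI : Fact ℓ.Prime := hℓ
  haveI : NeZero ℓ := ⟨hℓ.out.ne_zero⟩
  /- 1. the Heisenberg character at `u` -/
  obtain ⟨gu, ru, ιu, hgu, hιu, jsu, hjsu, hbru⟩ := hu
  obtain ⟨σ, f, hf1, hfe⟩ := exists_hom_heisenberg_single_cusp hgu (jsu be) ℓ
  -- the Heisenberg group as a finite discrete group
  letI : TopologicalSpace (Multiplicative (ZMod ℓ × ZMod ℓ) ⋊[σ] Multiplicative (ZMod ℓ)) := ⊥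
  haveI : DiscreteTopology (Multiplicative (ZMod ℓ × ZMod ℓ) ⋊[σ] Multiplicative (ZMod ℓ)) := ⟨rfl⟩
  haveI : Finite (Multiplicative (ZMod ℓ × ZMod ℓ) ⋊[σ] Multiplicative (ZMod ℓ)) :=
    Finite.of_equiv _ SemidirectProduct.equivProd.symm
  have hcard : Nat.card (Multiplicative (ZMod ℓ × ZMod ℓ) ⋊[σ] Multiplicative (ZMod ℓ)) = ℓ ^ 3 := by
    rw [SemidirectProduct.card]
    change Nat.card (ZMod ℓ × ZMod ℓ) * Nat.card (ZMod ℓ) = ℓ ^ 3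
    rw [Nat.card_prod, Nat.card_zmod]
    ring
  have hKS : IsSigmaInteger Sigma f.ker.index := by
    refine (IsProSigmaCompletion.isSigmaInteger_prime_pow hℓ.out hℓS 3).of_dvd ?_
    have h : f.ker.index ∣ Nat.card (Multiplicative (ZMod ℓ × ZMod ℓ) ⋊[σ] Multiplicative (ZMod ℓ)) :=
      index_ker_dvd_card f
    rwa [hcard] at h
  obtain ⟨Λ, hΛo, hΛι, -⟩ := hιu.exists_hom_extension f hKS
  let χu : 𝒢.Gv u →ₜ* (Multiplicative (ZMod ℓ × ZMod ℓ) ⋊[σ] Multiplicative (ZMod ℓ)) :=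
    ⟨Λ, continuous_of_isOpen_ker Λ hΛo⟩
  let χ : ∀ v : 𝒢.graph.Vertex, 𝒢.Gv v →ₜ* (Multiplicative (ZMod ℓ × ZMod ℓ) ⋊[σ] Multiplicative (ZMod ℓ)) :=
    fun v => if h : v = u then h ▸ χu else 1
  have hχu : χ u = χu := by
    change (if h : u = u then h ▸ χu else 1) = χu
    rw [dif_pos rfl]
  have hχo : ∀ v, v ≠ u → χ v = 1 := fun v h => by
    change (if h : v = u then h ▸ χu else 1) = 1
    rw [dif_neg h]
  /- 2. values on the branch groups at `u`: trivial off `be`, non-trivial at `be` -/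
  have hvalue : ∀ (b : 𝒢.graph.Star u) (t : 𝒢.Ge (𝒢.graph.edgeOf b.1)), ∃ (x : 𝒢.Gv u) (k : ℤ),
      χu (𝒢.brHom b.1 u b.2 t) = Λ x * f (PuncturedSurfaceGroup.c (jsu b)) ^ k * (Λ x)⁻¹ := by
    intro b t
    obtain ⟨x, hB⟩ := hbru b
    have hmem : 𝒢.brHom b.1 u b.2 t ∈ 𝒢.branchSubgroup b.1 u b.2 := ⟨t, rfl⟩
    rw [hB] at hmem
    obtain ⟨y, hy, hyt⟩ := (Subgroup.mem_smul_pointwise_iff_exists _ _ _).mp hmem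
    obtain ⟨s, ⟨k, rfl⟩, hs⟩ := apply_mem_map_of_mem_closure Λ hΛo _
      (by rw [cuspInertia, MonoidHom.map_zpowers] at hy; exact hy)
    refine ⟨x, k, ?_⟩
    change Λ (𝒢.brHom b.1 u b.2 t) = _
    rw [← hyt, ConjAct.toConjAct_smul, map_mul, map_mul, map_inv, ← hs, map_zpow, hΛι]
  have hT : ∀ (b : 𝒢.graph.Branch) (v : 𝒢.graph.Vertex) (hb : 𝒢.graph.abuts b = some v),
      b ≠ be.1 → ∀ t, χ v (𝒢.brHom b v hb t) = 1 := by
    intro b v hb n1 t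
    by_cases hvu : v = u
    · subst hvu
      obtain ⟨x, k, hk⟩ := hvalue ⟨b, hb⟩ t
      rw [hf1 (jsu ⟨b, hb⟩) (fun h => n1 (congrArg Subtype.val (hjsu h))), one_zpow, mul_one, mul_inv_cancel] at hk
      rw [hχu]
      exact hk
    · rw [hχo v hvu]
      rfl
  have hglue : ∀ (b : 𝒢.graph.Branch) (v : 𝒢.graph.Vertex) (hb : 𝒢.graph.abuts b = some v)
      (b' : 𝒢.graph.Branch) (v' : 𝒢.graph.Vertex) (hb' : 𝒢.graph.abuts b' = some v')
      (he : 𝒢.graph.edgeOf b' = 𝒢.graph.edgeOf b), b' ≠ b →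
      ∃ A : (Multiplicative (ZMod ℓ × ZMod ℓ) ⋊[σ] Multiplicative (ZMod ℓ)) ≃
          (Multiplicative (ZMod ℓ × ZMod ℓ) ⋊[σ] Multiplicative (ZMod ℓ)),
        ∀ (t : 𝒢.Ge (𝒢.graph.edgeOf b)) (m : Multiplicative (ZMod ℓ × ZMod ℓ) ⋊[σ] Multiplicative (ZMod ℓ)),
          A ((he ▸ (χ v').comp (𝒢.brHom b' v' hb') : 𝒢.Ge (𝒢.graph.edgeOf b) →ₜ* _) t * m) =
            χ v (𝒢.brHom b v hb t) * A m := by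
    intro b v hb b' v' hb' he hbb
    have hb1 : b ≠ be.1 := fun h => by
      subst h; exact absurd (hopen b' he hbb) (by rw [hb']; exact Option.some_ne_none v')
    have hb1' : b' ≠ be.1 := fun h => by
      subst h; exact absurd (hopen b he.symm (Ne.symm hbb)) (by rw [hb]; exact Option.some_ne_none v)
    refine ⟨Equiv.refl _, fun t m => ?_⟩
    rw [Equiv.refl_apply, Equiv.refl_apply, hT b v hb hb1 t,
      forall_transport χ hb' he (P := fun m => m = 1) (hT b' v' hb' hb1') t]
  /- 3. the covering, split over `w`, moved by `Π_e` -/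
  obtain ⟨S, hfin, hV, hE⟩ := exists_cover χ hglue
  have hfix : ∀ (γ : 𝒢.Gv w) (s : (S.SV w).obj.V), (S.SV w).obj.ρ γ s = s := fun γ =>
    (hV w γ).mpr (by rw [hχo w (Ne.symm huw)]; rfl)
  have hmove : ∃ (γ : 𝒢.Ge (𝒢.graph.edgeOf be.1)) (s : (S.SE (𝒢.graph.edgeOf be.1)).obj.V),
      (S.SE (𝒢.graph.edgeOf be.1)).obj.ρ γ s ≠ s := by
    -- the conjugated cusp generator `x ι(c_{j_e}) x⁻¹ ∈ b_*(Π_e)` has value `Λx · z⁻¹ · (Λx)⁻¹ ≠ 1`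
    obtain ⟨x, hB⟩ := hbru be
    obtain ⟨t₀, ht₀, -⟩ := exists_dense_zpowers_edgeGroup be.1 u be.2 (h36.isOfInjectiveType be.1 u be.2) ιu x
      (jsu be) hB
    by_contra hcon
    have hall : ∀ s, (S.SE (𝒢.graph.edgeOf be.1)).obj.ρ t₀ s = s := fun s =>
      not_not.mp fun hs => hcon ⟨t₀, s, hs⟩
    have h := (hE be.1 u be.2 t₀).mp hall
    rw [hχu] at h
    change Λ (𝒢.brHom be.1 u be.2 t₀) = 1 at h
    rw [ht₀, map_mul, map_mul, map_inv, hΛι, hfe, mul_inv_eq_one, mul_eq_left, inv_eq_one] at h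
    have h' := SemidirectProduct.inl_injective h
    rw [ofAdd_eq_one] at h'
    exact one_ne_zero (Prod.mk_eq_zero.mp h').2
  let T : BTempCat 𝒢 := ⟨S, FiniteIsTempered_holds 𝒢 h36.isConnected h36.isCountable S hfin⟩
  haveI : Finite (T.obj.SV w).obj.V := hfin.finite_V w
  obtain ⟨U, hU, hTU, hLU⟩ := TemperedPiChart.exists_openNormal_separating_decomp_singleVertex_of_covering
    h36.isQuasiCoherent h36.isGaloisCountable c T hfix hmove hTpH
  exact StableCurveTemperedData.not_map_le_conj_closure_of_openNormal c hι U hU hTU (hLU L hL) g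

end PositiveGenus

end Literature.IUT.HodgeTheaters
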